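/-
Copyright (c) 2026 the pub-hodgecm-mathlib formalisation cell (harness21).  Prover seat hodgecm-mathlib-R90-C10-p01 (g3), SLAB R90-TF, section S1 «Ch. 10∕12 local»;
crux H413 = `stmt-HodgeConjecture-24833`; line «B_pos» RAMIFIED TAME corner — leaf (8) BODY, dealt BY NAME by R90-C10-plan (g2) (2026-09-05T01:12:31Z; R-S1-20).
KERNEL module: THEOREMS ONLY (no definition, no named fact, no `sorry`, no instance, no notation).  2026-09-05.
-/
import Summits.HodgeConjecture.HodgeConjecture.Theorems.R90S1BposBranchBTypeBasisTwoDepthCM      -- ★ p863439 (B-1′): `exists_normalised_typeBasis_twoDepth_of_normChar_eq_one` (place-generic)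
import Summits.HodgeConjecture.HodgeConjecture.Theorems.K2E3BranchATypeVectorTwoDepth            -- ★ p863411 (B-1a): `exists_typeVector_twoDepth` (place-generic; trace-one `t`, `hcondF` letters)
import Summits.HodgeConjecture.HodgeConjecture.Theorems.R90S1BposRamCellCoverTwoDepthKZeroCM       -- ★ p863673 (B-10)(2) (R90-C10-p08 (g2)): `cells_witness_kZero_ram` (`he h2w`); brings ★ p863461 `cells_cover_kZero` (place-free)
import Summits.HodgeConjecture.HodgeConjecture.Theorems.R90S1BranchBDeterminantVanishingCells      -- ★ p862976 (B-0): `det_intertwiningIntegral_eq_zero_of_typeVector_of_cells` (generic)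
import Summits.HodgeConjecture.HodgeConjecture.Theorems.R90S1BposRamDeterminantClosedForm          -- ★ p864034 (B-10)(7) (this seat): `exists_eta_of_det_eq_zero_of_pairEntries_ram_posDepth` (→ ★ (7a)), `det_ne_zero_of_bigCell_zero_ram` ((R-a))
import Summits.HodgeConjecture.HodgeConjecture.Theorems.R90S1BposCongruencePackTheta               -- ★ p863453 (B-8): `exists_isOpen_subgroup_theta_eq_one`, `theta_mul_twoDepth` (θ-letters, `hcondF` as a letter)
import Summits.HodgeConjecture.HodgeConjecture.Theorems.R90S1BposRamFixedPrincipalUnits            -- ★ p863838 (B-10)(1) (R90-C10-p08 (g2)): `hcondF_of_branchB_of_tame`, `apply_eq_one_of_branchB_of_fixed_principal_ram` (tame: `χ₁ = 1` on `1 + 𝔭_F`)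
import Summits.HodgeConjecture.HodgeConjecture.Theorems.R90S1BposRamConductorEven                  -- ★ p863739 (B-10)(4) (R90-C10-p06 (g3)): `even_succ_of_conductorLetters_of_fixedPrincipal` (`n = m + 1` EVEN)
import Summits.HodgeConjecture.HodgeConjecture.Theorems.R90S1BranchBConstantsRamified              -- ★ p05 (g0): `norm_apply_norm_uniformizer_lt_one` (`|χ₁(σΠ·Π)| < 1`)
import Summits.HodgeConjecture.HodgeConjecture.Theorems.K2E3LocalCharacterConductorLetters         -- ★ p862864 (B1): `exists_conductor_letters`
import Literature.NumberTheory.Automorphic.HeisenbergStrataMeasureRamified                        -- ★ `exists_unit_valued_apply_eq_exp_neg_one` (a uniformiser unit `Π` of `L ⊗ L⁺_v`)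
import Literature.NumberTheory.Automorphic.Liu2021.LemD1AsPrintedIndexedNonVacuityTameSynthesis   -- ★ `isUnramifiedIn_of_ramificationIdx'_eq_one` (reads the guard `¬ IsUnramifiedIn` at the unique `w ∣ v`)
import HarnessLib

/-!
# R90-TF · S1 «Ch10-local» ∕ K2 E3 «U4Keys» :182, BRANCH B AT POSITIVE DEPTH, TAMELY RAMIFIED PLACE — THE LEAF (8) BODY, HYPOTHESIS-FIRST:
# `i(χ₁, 1)` reducible, `χ₁` continuous non-unitary contracting of POSITIVE depth with `χ₁(u·σu) = 1` on units, `v` ramified with `|2|_w = 1` ⟹ `χ₁ = η·‖·‖^{1∕2}`,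
# GIVEN the Casselman-pair entries at Roche's `J_e` in the letters of ★ (B-10)(7) (the (R-b) Γ-shapes, or the (R-a) zeros) — twin of ★ p863671 `R90S1KeysThmTwoPosDepthBranchBInertAllLeaf`
# [Keys1984 §3, §7 Thm (2) (d); Casselman1980 §3; Roche1998 §3–§4; Rogawski1990 §12.2]

Cell `pub/hodgecm-mathlib`, crux H413 = `stmt-HodgeConjecture-24833`, route of record `HCCMUnconditional` (no route verbs); R90-TF section S1 (base R90-C10), dealer
R90-C10-plan (g2) (R-S1-20 + 01:12:31Z), line lead R90-C10-p05 (g2) (head pen), auditor R90-C10-audit1 (g2).  THEOREMS ONLY; lane `--supports stmt-HodgeConjecture-24833 --as helper`,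
count-neutral.  NOT THE PAYER of :182: §2's letter `HEram` (the four entries on every frame) is paid by the ramified analytic bricks (5)(6) after P-ram-1 reconciliation.

WHAT (p08 (g2) census `CENSUS-Bpos-ramified-posdepth.md` 3c8eaa3bd4b223c1 + this seat's `PAPER-Pram1-cross.md` 285001636e231ee7).  At a TAME RAMIFIED non-split `v` (`he`,
`|2|_w = 1`), Branch B gives `χ₁ = 1` on `1 + 𝔭_F` (★ (1)), hence an EVEN conductor `n = m + 1 = 2ν` (★ (4)) and Roche's group `J_e` at `e = (ν, 0; ν, 1)`; the type side
of line (D-1) is place-generic (★ (B-1′), ★ (B-1a) with `t := 2⁻¹`, `hcondF := ★ (1)`; ★ (B-2b″)'s cover verbatim + ★ (2)'s ramified witnesses); ★ (B-0) gives `det M = 0` on the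
`(J_e, θ)`-plane; the four entries are either the (R-a) ZEROS (`χ₁|_{𝒪_F^×} = 1`: every shell vanishes ⇒ `det = −q^{−n}V₁V₂ ≠ 0`, ABSURD, ★ (7) §4) or the (R-b) Γ-SHAPES
(`Λ_1 f₁ = V₁ΓX∕(1−X) = Λ_{w₀} f_w∕V₂·V₁`, `Γ²X = (q−1)²q^{−n−1}`, with the sub-branch witness `hFε`) ⇒ ★ (7) `exists_eta_of_det_eq_zero_of_pairEntries_ram_posDepth` ⇒ ★ (7a).
* §1 **`exists_eta_of_reducible_twoDepth_of_pairEntries_ram`** — the END ASSEMBLY in the (G3) frame at `J_e` (`r₁ = r₂ = ν`), GIVEN a normalised type basis and the entries as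
  a DISJUNCTION «(R-a) zeros ∨ (R-b) Γ-shapes + `hFε`» (`X = χ₁(σΠ·Π)` at a uniformiser unit `Π` of the frame, `q = N𝔓_w`).
* §2 **`exists_eta_of_reducible_posDepth_normTrivial_ramifiedTame_of_pairEntries`** — frame-free, hypothesis-first: the TAME head binders (typ2 (g3) fa479885beeb3078:
  `hns hrf h2 χ₁ h₁ hnu hcontr hram hpos hB hred`; `hram` unused hence not a binder) + ONE letter `HEram` (the entries on every frame ∕ basis ∕ uniformiser unit) ⊢ disjunct 2 of :182.
HONEST LABEL.  HC_CM is proved only modulo the 7 printed citations (2 remaining named inputs: hLiu418 = `stmt-HodgeConjecture-24832`, h413 = `stmt-HodgeConjecture-24833`) until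
rung 0 closes; this file closes NOTHING at rung 0 (modulo `HEram`; :182 ∕ A2′ ∕ (S-RT) OPEN); no printed citation is discharged; REL ≠ ★ ≠ BUILT.

## References
* [Keys1984] D. Keys, *Principal series representations of special unitary groups over local fields*, Compositio Math. 51 (1984), §3, §7 Theorem (2) (b)–(d) p. 126.
* [Casselman1980] W. Casselman, *The unramified principal series of p-adic groups I*, Compositio Math. 40 (1980), §3.
* [Roche1998] A. Roche, *Types and Hecke algebras for principal series representations of split reductive p-adic groups*, Ann. Sci. ÉNS (4) 31 (1998), §3–§4.
* [Rogawski1990] J. D. Rogawski, *Automorphic Representations of Unitary Groups in Three Variables*, Ann. of Math. Stud. 123 (1990), §12.2 (1)–(2) p. 173.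
-/

set_option autoImplicit false
-- the mandated namespace has the single-problem summit's repeated segment (`HodgeConjecture.HodgeConjecture`)
set_option linter.dupNamespace false

noncomputable section

open NumberField IsDedekindDomain MeasureTheory
open scoped Matrix MatrixGroups WithZero Valued NNReal
open Literature.NumberTheory Literature.NumberTheory.Automorphic Literature.NumberTheory.Automorphic.UnitaryGroup
open Literature.NumberTheory.Rogawski1990

namespace Summit.HodgeConjecture.HodgeConjecture.R90.S1.KeysThmTwoPosDepthBranchBRamifiedTameLeaf

open Summit.HodgeConjecture.HodgeConjecture.Cruxes.H413
open Summit.HodgeConjecture.HodgeConjecture.Cruxes.H413.K2E3DepthZeroIwahoriCharacterCM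
open Summit.HodgeConjecture.HodgeConjecture.R90.S1
open Literature.NumberTheory.Automorphic.Liu2021.LemD1IndexedNonVacuityTameSynthesis (isUnramifiedIn_of_ramificationIdx'_eq_one)

variable (L : Type) [Field L] [NumberField L] [IsCMField L] (v : HeightOneSpectrum (𝓞 ↥(maximalRealSubfield L)))

/-! ## §1 The end assembly in the (G3) frame at Roche's group `J_e`, `e = (ν, 0; ν, 1)`, GIVEN the type basis and the entries ((R-a) zeros ∨ (R-b) Γ-shapes) -/

section Frame

variable (w : PlacesOver L v) (hw : IsCMField.complexConj L • w.1 = w.1)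
  (eA : Gqs L v ≃ₜ* ↥(unitaryGroupOfForm (galAdicCompletionMap (L := L) (IsCMField.complexConj L) hw) ((StdForm.antidiagonal 3).over (w.1.adicCompletion L))))
  (heA : ∀ g : Gqs L v,
    ((eA g : ↥(unitaryGroupOfForm (galAdicCompletionMap (L := L) (IsCMField.complexConj L) hw) ((StdForm.antidiagonal 3).over (w.1.adicCompletion L)))) :
        GL (Fin 3) (w.1.adicCompletion L)) =
      ((localNonsplitEquiv (IsCMField.complexConj L) (qsForm L) (IsCMField.complexConj_ne_one L) w hw g :
        ↥(unitaryGroupOfForm (galAdicCompletionMap (L := L) (IsCMField.complexConj L) hw) (placeForm (qsForm L) w.1))) : GL (Fin 3) (w.1.adicCompletion L)))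
  {ϖ : w.1.adicCompletion L} (hϖ : Valued.v ϖ = WithZero.exp (-1 : ℤ))
  (g₁ : GL (Fin 3) (w.1.adicCompletion L)) (hg₁ : (g₁ : Matrix (Fin 3) (Fin 3) (w.1.adicCompletion L)) = Matrix.diagonal ![(1 : w.1.adicCompletion L), 1, ϖ])
  (K0 K1 I : Subgroup (Gqs L v))
  (hK0 : K0 = ((glInt 3 (w.1.adicCompletion L)).subgroupOf
    (unitaryGroupOfForm (galAdicCompletionMap (L := L) (IsCMField.complexConj L) hw) ((StdForm.antidiagonal 3).over (w.1.adicCompletion L)))).comap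
      eA.toMulEquiv.toMonoidHom)
  (hK1 : K1 = (((glInt 3 (w.1.adicCompletion L)).map (MulAut.conj g₁).toMonoidHom).subgroupOf
    (unitaryGroupOfForm (galAdicCompletionMap (L := L) (IsCMField.complexConj L) hw) ((StdForm.antidiagonal 3).over (w.1.adicCompletion L)))).comap
      eA.toMulEquiv.toMonoidHom)
  (hI : I = K0 ⊓ K1)
  (ν : ℕ) (Jg : Subgroup ↥(unitaryGroupOfForm (galAdicCompletionMap (L := L) (IsCMField.complexConj L) hw) ((StdForm.antidiagonal 3).over (w.1.adicCompletion L))))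
  (hJg : ∀ k : ↥(unitaryGroupOfForm (galAdicCompletionMap (L := L) (IsCMField.complexConj L) hw) ((StdForm.antidiagonal 3).over (w.1.adicCompletion L))),
    k ∈ Jg ↔ ∀ i j, Valued.v (((k : GL (Fin 3) (w.1.adicCompletion L)) : Matrix (Fin 3) (Fin 3) (w.1.adicCompletion L)) i j) ≤
      Valued.v ϖ ^ (![![0, ν, 0], ![ν, 0, ν], ![1, ν, 0]] : Fin 3 → Fin 3 → ℕ) i j)
  (Je : Subgroup (Gqs L v)) (hJe : Je = Jg.comap eA.toMulEquiv.toMonoidHom)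
  (w₀ : ↥(unitaryGroupOfForm (conjLocal L (IsCMField.complexConj L) v) (cmLocalForm L 3 v))) (hw₀ : Units.val (w₀ : GL (Fin 3) (LocalRing L v)) = cmLocalForm L 3 v)

open Classical in
include hw heA hϖ hg₁ hK0 hK1 hI hJg hJe hw₀ in
set_option maxHeartbeats 4000000 in
set_option synthInstance.maxHeartbeats 400000 in
-- the `SmoothInd` carrier on `U(Φ₃)(L⁺_v)` (class of ★ (B-1a) ∕ ★ p863671): ★ letters typed on `Gqs L v` meet ★ (B-0)'s generic binders by `exact`
/-- **THE B_pos END ASSEMBLY IN THE (G3) FRAME AT ROCHE'S GROUP `J_e`, TAME RAMIFIED PLACE, GIVEN THE TYPE BASIS AND THE ENTRIES.**  `v` non-split (`hns`) and RAMIFIED in `L`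
at `w` (`he`), TAME (`|2|_w = 1`); `Π` a uniformiser unit (`|Π_{w′}| = exp(−1)`); `χ₁ : (L ⊗ L⁺_v)ˣ → ℂˣ` continuous, non-unitary, contracting, of conductor `m + 1` (`hcond`, witness
`u₁`, `1 ≤ m`) with `m + 1 = ν + ν` (even, ★ (4)), `χ₁(u·σu) = 1` on units of valuation one (Branch B); `Je = eA⁻¹(J_e)`, `e = (ν, 0; ν, 1)`; `w₀` of matrix `Φ₃`; `μ` a Haar
measure on `N(L⁺_v)`; `(f₁, f_w)` a NORMALISED `(J_e, θ)`-type basis with integrable cell integrals `Λ_g f = ∫_N f(w₀ n g) dμ`; the two VOLUMES `Λ_1 f_w = (q^ν)⁻¹V₂`,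
`Λ_{w₀} f₁ = (q^ν)⁻¹V₁` (`q = N𝔓_w`, `V₁, V₂ ≠ 0`); and the two BIG-CELL entries EITHER both `0` (sub-branch (R-a)) OR `V₁·ΓX∕(1−X)`, `V₂·ΓX∕(1−X)` with `Γ²X = (q−1)²(q^{2ν+1})⁻¹`
together with the (R-b) witness `hFε` (`X = χ₁(σΠ·Π)`).  If `i(χ₁, 1)` is reducible then **`χ₁ = η·‖·‖^{1∕2}` for a continuous quadratic character extension `η`** (disjunct 2 of
:182).  Proof: ★ (B-1a) (`t := 2⁻¹`, `hcondF` ★ (1), `k = 0`) ⟹ type vector; ★ (B-2b″) cover + ★ (2) ramified witnesses; ★ (B-0) ⟹ `det M = 0`; (R-a): ★ (7) §4 contradicts it;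
(R-b): ★ `norm_apply_norm_uniformizer_lt_one`, ★ (7) `exists_eta_of_det_eq_zero_of_pairEntries_ram_posDepth` (→ ★ (7a)). [cite: Keys1984, §3, §7 Theorem (2) (d) p. 126]
[cite: Casselman1980, §3] [cite: Roche1998, §3–§4] [cite: Rogawski1990, §12.2 (1)–(2) p. 173] -/
theorem exists_eta_of_reducible_twoDepth_of_pairEntries_ram
    (hns : ∀ w' : PlacesOver L v, IsCMField.complexConj L • w'.1 = w'.1) (he : v.asIdeal.ramificationIdx' w.1.asIdeal ≠ 1)
    (h2w : Valued.v (2 : w.1.adicCompletion L) = 1)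
    (piU : (LocalRing L v)ˣ) (hpiU : ∀ w' : PlacesOver L v, Valued.v ((piU : LocalRing L v) w') = WithZero.exp (-1 : ℤ))
    (χ₁ : (LocalRing L v)ˣ →* ℂˣ) (h₁ : Continuous fun x => ((χ₁ x : ℂˣ) : ℂ)) (hnu : ∃ x, ‖((χ₁ x : ℂˣ) : ℂ)‖ ≠ 1)
    (hcontr : ∀ x : (LocalRing L v)ˣ, unitModulusChar (LocalRing L v) x < 1 → ‖((χ₁ x : ℂˣ) : ℂ)‖ < 1)
    (hB : ∀ u : (LocalRing L v)ˣ, (∀ w' : PlacesOver L v, Valued.v ((u : LocalRing L v) w') = 1) →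
      χ₁ (u * Units.map (conjLocal L (IsCMField.complexConj L) v : LocalRing L v →* LocalRing L v) u) = 1)
    {m : ℕ} (hm : 1 ≤ m)
    (hcond : ∀ u : (LocalRing L v)ˣ, (∀ w' : PlacesOver L v, Valued.v (((u : LocalRing L v) w') - 1) ≤ Valued.v ϖ ^ (m + 1)) → χ₁ u = 1)
    (u₁ : (LocalRing L v)ˣ) (hu₁ : ∀ w' : PlacesOver L v, Valued.v (((u₁ : LocalRing L v) w') - 1) ≤ Valued.v ϖ ^ m) (hχu₁ : χ₁ u₁ ≠ 1)
    (hνν : ν + ν = m + 1)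
    [MeasurableSpace ↥(cmBorelTriple L 3 v).N] [BorelSpace ↥(cmBorelTriple L 3 v).N] (μ : Measure ↥(cmBorelTriple L 3 v).N) [μ.IsHaarMeasure]
    (f₁ f_w : haveI := locallyCompactSpace_cmBorelU L 3 v
      Representation.SmoothInd (cmBorelTriple L 3 v).P
        (Representation.twist (((Representation.trivial ℂ ↥(torusU (conjLocal L (IsCMField.complexConj L) v) (cmLocalForm L 3 v)) ℂ).twist
          (cmTorusCharPair L v χ₁ 1)).comp (cmBorelTriple L 3 v).proj) (rootDeltaChar (cmBorelTriple L 3 v).P)))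
    (heig₁ : ∀ x ∈ Je, (haveI := locallyCompactSpace_cmBorelU L 3 v; Representation.smoothIndRep _ _ x f₁) =
      (if h : IsUnit (((x.val : GL (Fin 3) (LocalRing L v)) : Matrix (Fin 3) (Fin 3) (LocalRing L v)) 0 0) then ((χ₁ h.unit : ℂˣ) : ℂ) else 0) • f₁)
    (heig_w : ∀ x ∈ Je, (haveI := locallyCompactSpace_cmBorelU L 3 v; Representation.smoothIndRep _ _ x f_w) =
      (if h : IsUnit (((x.val : GL (Fin 3) (LocalRing L v)) : Matrix (Fin 3) (Fin 3) (LocalRing L v)) 0 0) then ((χ₁ h.unit : ℂˣ) : ℂ) else 0) • f_w)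
    (h11 : f₁.toFun 1 = 1) (h1g : f₁.toFun w₀ = 0) (hw1 : f_w.toFun 1 = 0) (hwg : f_w.toFun w₀ = 1)
    (hi₁₁ : Integrable (fun n : ↥(cmBorelTriple L 3 v).N => f₁.toFun (w₀ * (n : ↥(unitaryGroupOfForm (conjLocal L (IsCMField.complexConj L) v) (cmLocalForm L 3 v))) * 1)) μ)
    (hiw₁ : Integrable (fun n : ↥(cmBorelTriple L 3 v).N => f_w.toFun (w₀ * (n : ↥(unitaryGroupOfForm (conjLocal L (IsCMField.complexConj L) v) (cmLocalForm L 3 v))) * 1)) μ)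
    (hi₁₂ : Integrable (fun n : ↥(cmBorelTriple L 3 v).N => f₁.toFun (w₀ * (n : ↥(unitaryGroupOfForm (conjLocal L (IsCMField.complexConj L) v) (cmLocalForm L 3 v))) * w₀)) μ)
    (hiw₂ : Integrable (fun n : ↥(cmBorelTriple L 3 v).N => f_w.toFun (w₀ * (n : ↥(unitaryGroupOfForm (conjLocal L (IsCMField.complexConj L) v) (cmLocalForm L 3 v))) * w₀)) μ)
    (V₁ V₂ : ℂ) (hV₁ : V₁ ≠ 0) (hV₂ : V₂ ≠ 0)
    (hw1v : ∫ n : ↥(cmBorelTriple L 3 v).N, f_w.toFun (w₀ * (n : ↥(unitaryGroupOfForm (conjLocal L (IsCMField.complexConj L) v) (cmLocalForm L 3 v))) * 1) ∂μ =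
      (((Ideal.absNorm w.1.asIdeal : ℝ) : ℂ) ^ ν)⁻¹ * V₂)
    (h1wv : ∫ n : ↥(cmBorelTriple L 3 v).N, f₁.toFun (w₀ * (n : ↥(unitaryGroupOfForm (conjLocal L (IsCMField.complexConj L) v) (cmLocalForm L 3 v))) * w₀) ∂μ =
      (((Ideal.absNorm w.1.asIdeal : ℝ) : ℂ) ^ ν)⁻¹ * V₁)
    (hbig : (∫ n : ↥(cmBorelTriple L 3 v).N, f₁.toFun (w₀ * (n : ↥(unitaryGroupOfForm (conjLocal L (IsCMField.complexConj L) v) (cmLocalForm L 3 v))) * 1) ∂μ = 0 ∧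
        ∫ n : ↥(cmBorelTriple L 3 v).N, f_w.toFun (w₀ * (n : ↥(unitaryGroupOfForm (conjLocal L (IsCMField.complexConj L) v) (cmLocalForm L 3 v))) * w₀) ∂μ = 0) ∨
      ((∃ a : (LocalRing L v)ˣ, Units.map (conjLocal L (IsCMField.complexConj L) v : LocalRing L v →* LocalRing L v) a = a ∧
          (∀ w' : PlacesOver L v, Valued.v ((a : LocalRing L v) w') = 1) ∧ χ₁ a ≠ 1) ∧
        ∃ Γ : ℂ, Γ ^ 2 * ((χ₁ (Units.map (conjLocal L (IsCMField.complexConj L) v : LocalRing L v →* LocalRing L v) piU * piU) : ℂˣ) : ℂ) =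
            (((Ideal.absNorm w.1.asIdeal : ℝ) : ℂ) - 1) ^ 2 * ((((Ideal.absNorm w.1.asIdeal : ℝ) : ℂ)) ^ (2 * ν + 1))⁻¹ ∧
          ∫ n : ↥(cmBorelTriple L 3 v).N, f₁.toFun (w₀ * (n : ↥(unitaryGroupOfForm (conjLocal L (IsCMField.complexConj L) v) (cmLocalForm L 3 v))) * 1) ∂μ =
            V₁ * (Γ * ((χ₁ (Units.map (conjLocal L (IsCMField.complexConj L) v : LocalRing L v →* LocalRing L v) piU * piU) : ℂˣ) : ℂ) /
              (1 - ((χ₁ (Units.map (conjLocal L (IsCMField.complexConj L) v : LocalRing L v →* LocalRing L v) piU * piU) : ℂˣ) : ℂ))) ∧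
          ∫ n : ↥(cmBorelTriple L 3 v).N, f_w.toFun (w₀ * (n : ↥(unitaryGroupOfForm (conjLocal L (IsCMField.complexConj L) v) (cmLocalForm L 3 v))) * w₀) ∂μ =
            V₂ * (Γ * ((χ₁ (Units.map (conjLocal L (IsCMField.complexConj L) v : LocalRing L v →* LocalRing L v) piU * piU) : ℂˣ) : ℂ) /
              (1 - ((χ₁ (Units.map (conjLocal L (IsCMField.complexConj L) v : LocalRing L v →* LocalRing L v) piU * piU) : ℂˣ) : ℂ)))))
    (hred : ∃ N : Subrepresentation (cmPrincipalSeries L 3 v (cmTorusCharPair L v χ₁ 1)), N ≠ ⊥ ∧ N ≠ ⊤) :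
    ∃ η : (LocalRing L v)ˣ →* ℂˣ, IsQuadraticCharExtension (conjLocal L (IsCMField.complexConj L) v) η ∧
      Continuous (fun x => ((η x : ℂˣ) : ℂ)) ∧ χ₁ = η * halfModulusChar (LocalRing L v) := by
  haveI := locallyCompactSpace_cmBorelU L 3 v
  -- the trace-one letter at a tame place: `t := 2⁻¹`; the F-conductor letter at `c = 1` from Branch B (★ (1): squares in `1 + 𝔭_F`)
  have ht : (2⁻¹ : w.1.adicCompletion L) + galAdicCompletionMap (L := L) (IsCMField.complexConj L) hw 2⁻¹ = 1 := by
    rw [map_inv₀, map_ofNat, ← two_mul, mul_inv_cancel₀ two_ne_zero]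
  have hvt : Valued.v (2⁻¹ : w.1.adicCompletion L) ≤ 1 := by rw [map_inv₀, h2w, inv_one]
  have hcondF : ∀ u : (LocalRing L v)ˣ, Units.map (conjLocal L (IsCMField.complexConj L) v : LocalRing L v →* LocalRing L v) u = u →
      (∀ w' : PlacesOver L v, Valued.v (((u : LocalRing L v) w') - 1) ≤ Valued.v ϖ ^ (0 + 1)) → χ₁ u = 1 :=
    BposRamFixedPrincipalUnits.hcondF_of_branchB_of_tame L v w h2w hϖ le_rfl χ₁ hB
  -- ★ (B-1a): the `(J_e, θ)`-type vector of the reducible `i(χ₁, 1)`, killed by every `Λ_g`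
  obtain ⟨f', heig', hf'1, hΛ'⟩ := K2E3BranchATypeVectorTwoDepth.exists_typeVector_twoDepth L v w hw eA heA hϖ g₁ hg₁ K0 K1 I hK0 hK1 hI ν 0 ν 1 Jg hJg Je hJe
    (by omega) le_rfl hns χ₁ h₁ hnu hcontr (Nat.zero_le m) hcond hcondF ht hvt (by omega) (by omega) (by omega) (by omega) w₀ hw₀ μ hred
  -- ★ (B-2b″) cover (place-free) + ★ (2) ramified witnesses
  obtain ⟨R, hR⟩ : ∃ R : Set ↥(unitaryGroupOfForm (conjLocal L (IsCMField.complexConj L) v) (cmLocalForm L 3 v)), ∀ r, r ∈ R ↔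
      r ∈ ((cmBorelTriple L 3 v).N).map (MulAut.conj w₀).toMonoidHom ∧ r ∉ Je ∧
        ¬ (Valued.v ((((eA r : ↥(unitaryGroupOfForm (galAdicCompletionMap (L := L) (IsCMField.complexConj L) hw) ((StdForm.antidiagonal 3).over (w.1.adicCompletion L)))) : GL (Fin 3) (w.1.adicCompletion L)) : Matrix (Fin 3) (Fin 3) (w.1.adicCompletion L)) 2 1 /
              (((eA r : ↥(unitaryGroupOfForm (galAdicCompletionMap (L := L) (IsCMField.complexConj L) hw) ((StdForm.antidiagonal 3).over (w.1.adicCompletion L)))) : GL (Fin 3) (w.1.adicCompletion L)) : Matrix (Fin 3) (Fin 3) (w.1.adicCompletion L)) 2 0) ≤ Valued.v ϖ ^ ν ∧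
            (Valued.v ϖ ^ 0)⁻¹ ≤ Valued.v ((((eA r : ↥(unitaryGroupOfForm (galAdicCompletionMap (L := L) (IsCMField.complexConj L) hw) ((StdForm.antidiagonal 3).over (w.1.adicCompletion L)))) : GL (Fin 3) (w.1.adicCompletion L)) : Matrix (Fin 3) (Fin 3) (w.1.adicCompletion L)) 2 0)) :=
    ⟨{r | _}, fun _ => Iff.rfl⟩
  have hcells := BposCellCoverTwoDepthKZeroCM.cells_cover_kZero L v w hw eA heA hϖ ν ν Jg hJg Je hJe w₀ hw₀ R hR
  have hwit := BposRamCellCoverTwoDepthKZeroCM.cells_witness_kZero_ram L v w hw eA heA hϖ ν ν Jg hJg Je hJe w₀ hw₀ R hR hm hνν le_rfl (Nat.le_succ ν) he h2w χ₁ hcontr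
    hcond u₁ hu₁ hχu₁
  -- ★ (B-0): `det M = 0` on the `(J_e, θ)`-plane
  have hdet := BranchBDeterminantVanishingCells.det_intertwiningIntegral_eq_zero_of_typeVector_of_cells (cmBorelTriple L 3 v).P
    (Representation.twist (((Representation.trivial ℂ ↥(torusU (conjLocal L (IsCMField.complexConj L) v) (cmLocalForm L 3 v)) ℂ).twist
      (cmTorusCharPair L v χ₁ 1)).comp (cmBorelTriple L 3 v).proj) (rootDeltaChar (cmBorelTriple L 3 v).P))
    Je (fun g : ↥(unitaryGroupOfForm (conjLocal L (IsCMField.complexConj L) v) (cmLocalForm L 3 v)) =>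
      if h : IsUnit (((g : GL (Fin 3) (LocalRing L v)) : Matrix (Fin 3) (Fin 3) (LocalRing L v)) 0 0) then ((χ₁ h.unit : ℂˣ) : ℂ) else 0)
    w₀ _ hwit hcells (cmBorelTriple L 3 v).N μ w₀ 1 w₀ f₁ f_w heig₁ heig_w h11 h1g hw1 hwg hi₁₁ hiw₁ hi₁₂ hiw₂ f' heig' hf'1 (hΛ' 1) (hΛ' w₀)
  have hq0 : ((Ideal.absNorm w.1.asIdeal : ℝ) : ℂ) ≠ 0 := by
    have h : (1 : ℝ) < (Ideal.absNorm w.1.asIdeal : ℝ) := by exact_mod_cast NumberField.HeightOneSpectrum.one_lt_absNorm w.1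
    exact_mod_cast (lt_trans zero_lt_one h).ne'
  rcases hbig with ⟨h11z, hwwz⟩ | ⟨hFε, Γ, hΓ, h11v, hwwv⟩
  · -- (R-a): every shell vanishes, `det M = −(q^ν)⁻²V₁V₂ ≠ 0` — absurd
    exact absurd hdet (BposRamDeterminantClosedForm.det_ne_zero_of_bigCell_zero_ram ((Ideal.absNorm w.1.asIdeal : ℝ) : ℂ) V₁ V₂ _ _ _ _ ν hq0 hV₁ hV₂ h11z hwwz h1wv hw1v)
  · -- (R-b): `|X| < 1` and ★ (7)
    have hX := norm_apply_norm_uniformizer_lt_one L v hns w hw piU hpiU χ₁ hcontr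
    exact BposRamDeterminantClosedForm.exists_eta_of_det_eq_zero_of_pairEntries_ram_posDepth L v hns w hw piU hpiU χ₁ h₁ hB hFε ν Γ V₁ V₂ _ _ _ _ hV₁ hV₂ hX
      h11v hwwv h1wv hw1v hΓ hdet

end Frame

/-! ## §2 The leaf, frame-free, hypothesis-first: the TAME head binders + ONE letter `HEram` (the entries for every frame, uniformiser unit and type basis) -/

open Classical in
set_option maxHeartbeats 4000000 in
set_option synthInstance.maxHeartbeats 400000 in
-- §1 instantiated: the (G3) frame (★ leaf pattern), ★ (B1) conductor letters, ★ (4) `n = 2ν`, ★ D174 `Jg`, ★ (B-8) θ-letters (`t := 2⁻¹`, `hcondF` ★ (1)), ★ (B-1′) basis, `HEram`, `Measure.haar`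
/-- **U4Keys :182 IN BRANCH B AT POSITIVE DEPTH, TAMELY RAMIFIED PLACE — THE LEAF, HYPOTHESIS-FIRST.**  Binders = the TAME head `exists_eta_of_reducible_posDepth_normTrivial_ramifiedTame`
(typ2 (g3) fa479885beeb3078, in the `LocalRing` spelling of ★ p863671; `hram` is not used and therefore not a binder here): `v` non-split (`hns`) and RAMIFIED in `L` (`hrf`), TAME
(`h2`: `|2|_{w′} = 1`); `χ₁ : (L ⊗ L⁺_v)ˣ → ℂˣ` continuous (`h₁`), non-unitary (`hnu`), contracting (`hcontr`), of POSITIVE depth (`hpos`), with `χ₁(u·σu) = 1` on the units of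
valuation one (`hB`, Branch B); PLUS the one letter **`HEram`** = «in every (G3) frame `(w, eA, ϖ, g₁, K₀, K₁, I)` at the ramified tame `w` (`e(w|v) ≠ 1`, `|2|_w = 1`), for every
uniformiser unit `Π` (`|Π_{w′}| = exp(−1)`), every conductor datum `(m ≥ 1, hcond at |ϖ|^{m+1}, u₁ at |ϖ|ᵐ with χ₁ u₁ ≠ 1)`, every `ν` with `ν + ν = m + 1` and its two-depth group
`Je = eA⁻¹(Jg)`, `e = (ν, 0; ν, 1)`, every `w₀` of matrix `Φ₃`, every Borel Haar measure `μ` on `N(L⁺_v)` and every NORMALISED `(J_e, θ)`-type basis `(f₁, f_w)` of `i(χ₁, 1)`: the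
four cell integrals `∫_N f(w₀ n g) dμ` are integrable, the two volumes are `(q^ν)⁻¹V₂`, `(q^ν)⁻¹V₁` (`V₁, V₂ ≠ 0`, `q = N𝔓_w`), and the two big-cell entries are EITHER both `0` ((R-a))
OR the Γ-shapes `V_i·ΓX∕(1−X)` with `Γ²X = (q−1)²(q^{2ν+1})⁻¹` and the witness `hFε` ((R-b); `X = χ₁(σΠ·Π)`)» (payers: the ramified analytic bricks (5)(6) after P-ram-1).
If `i(χ₁, 1)` is reducible then **`χ₁ = η·‖·‖^{1∕2}` for a continuous quadratic character extension `η`** — DISJUNCT 2 of :182.  Proof: `e(w|v) ≠ 1` at the unique `w ∣ v`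
(★ `isUnramifiedIn_of_ramificationIdx'_eq_one`), `|2|_w = 1` (`h2`), the frame as ★ p863671 builds it, `Π` ★ `exists_unit_valued_apply_eq_exp_neg_one`, ★ (B1)
`exists_conductor_letters`, `ν` ★ (4) `even_succ_of_conductorLetters_of_fixedPrincipal` (`hfixP` ★ (1)), ★ D174 `exists_subgroup_forall_mem_iff_twoDepth`, `μ := Measure.haar`,
★ (B-8) `theta_mul_twoDepth` (`t := 2⁻¹`, `hcondF` ★ (1) `hcondF_of_branchB_of_tame`) + `exists_isOpen_subgroup_theta_eq_one`, ★ (B-1′), `HEram`, §1.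
[cite: Keys1984, §3, §7 Theorem (2) (b)–(d) p. 126] [cite: Casselman1980, §3] [cite: Roche1998, §3–§4] [cite: Rogawski1990, §12.2 (1)–(2) p. 173] -/
theorem exists_eta_of_reducible_posDepth_normTrivial_ramifiedTame_of_pairEntries
    (hns : ∀ w' : PlacesOver L v, IsCMField.complexConj L • w'.1 = w'.1)
    (hrf : ¬ Algebra.IsUnramifiedIn (𝓞 L) v.asIdeal)
    (h2 : ∀ w' : PlacesOver L v, Valued.v (2 : w'.1.adicCompletion L) = 1)
    (χ₁ : (LocalRing L v)ˣ →* ℂˣ) (h₁ : Continuous fun x => ((χ₁ x : ℂˣ) : ℂ)) (hnu : ∃ x, ‖((χ₁ x : ℂˣ) : ℂ)‖ ≠ 1)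
    (hcontr : ∀ x : (LocalRing L v)ˣ, unitModulusChar (LocalRing L v) x < 1 → ‖((χ₁ x : ℂˣ) : ℂ)‖ < 1)
    (hpos : ∃ u : (LocalRing L v)ˣ, (∀ w' : PlacesOver L v, Valued.v (((u : LocalRing L v) w') - 1) < 1) ∧ χ₁ u ≠ 1)
    (hB : ∀ u : (LocalRing L v)ˣ, (∀ w' : PlacesOver L v, Valued.v ((u : LocalRing L v) w') = 1) →
      χ₁ (u * Units.map (conjLocal L (IsCMField.complexConj L) v : LocalRing L v →* LocalRing L v) u) = 1)
    (HEram : ∀ (w : PlacesOver L v) (hw : IsCMField.complexConj L • w.1 = w.1)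
      (_he : v.asIdeal.ramificationIdx' w.1.asIdeal ≠ 1) (_h2w : Valued.v (2 : w.1.adicCompletion L) = 1)
      (eA : Gqs L v ≃ₜ* ↥(unitaryGroupOfForm (galAdicCompletionMap (L := L) (IsCMField.complexConj L) hw) ((StdForm.antidiagonal 3).over (w.1.adicCompletion L))))
      (_heA : ∀ g : Gqs L v,
        ((eA g : ↥(unitaryGroupOfForm (galAdicCompletionMap (L := L) (IsCMField.complexConj L) hw) ((StdForm.antidiagonal 3).over (w.1.adicCompletion L)))) :
            GL (Fin 3) (w.1.adicCompletion L)) =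
          ((localNonsplitEquiv (IsCMField.complexConj L) (qsForm L) (IsCMField.complexConj_ne_one L) w hw g :
            ↥(unitaryGroupOfForm (galAdicCompletionMap (L := L) (IsCMField.complexConj L) hw) (placeForm (qsForm L) w.1))) : GL (Fin 3) (w.1.adicCompletion L)))
      (ϖ : w.1.adicCompletion L) (_hϖ : Valued.v ϖ = WithZero.exp (-1 : ℤ))
      (piU : (LocalRing L v)ˣ) (_hpiU : ∀ w' : PlacesOver L v, Valued.v ((piU : LocalRing L v) w') = WithZero.exp (-1 : ℤ))
      (g₁ : GL (Fin 3) (w.1.adicCompletion L)) (_hg₁ : (g₁ : Matrix (Fin 3) (Fin 3) (w.1.adicCompletion L)) = Matrix.diagonal ![(1 : w.1.adicCompletion L), 1, ϖ])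
      (K0 K1 I : Subgroup (Gqs L v))
      (_hK0 : K0 = ((glInt 3 (w.1.adicCompletion L)).subgroupOf
        (unitaryGroupOfForm (galAdicCompletionMap (L := L) (IsCMField.complexConj L) hw) ((StdForm.antidiagonal 3).over (w.1.adicCompletion L)))).comap
          eA.toMulEquiv.toMonoidHom)
      (_hK1 : K1 = (((glInt 3 (w.1.adicCompletion L)).map (MulAut.conj g₁).toMonoidHom).subgroupOf
        (unitaryGroupOfForm (galAdicCompletionMap (L := L) (IsCMField.complexConj L) hw) ((StdForm.antidiagonal 3).over (w.1.adicCompletion L)))).comap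
          eA.toMulEquiv.toMonoidHom)
      (_hI : I = K0 ⊓ K1)
      (m : ℕ) (_hm : 1 ≤ m)
      (_hcond : ∀ u : (LocalRing L v)ˣ, (∀ w' : PlacesOver L v, Valued.v (((u : LocalRing L v) w') - 1) ≤ Valued.v ϖ ^ (m + 1)) → χ₁ u = 1)
      (u₁ : (LocalRing L v)ˣ) (_hu₁ : ∀ w' : PlacesOver L v, Valued.v (((u₁ : LocalRing L v) w') - 1) ≤ Valued.v ϖ ^ m) (_hχu₁ : χ₁ u₁ ≠ 1)
      (ν : ℕ) (_hνν : ν + ν = m + 1)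
      (Jg : Subgroup ↥(unitaryGroupOfForm (galAdicCompletionMap (L := L) (IsCMField.complexConj L) hw) ((StdForm.antidiagonal 3).over (w.1.adicCompletion L))))
      (_hJg : ∀ k : ↥(unitaryGroupOfForm (galAdicCompletionMap (L := L) (IsCMField.complexConj L) hw) ((StdForm.antidiagonal 3).over (w.1.adicCompletion L))),
        k ∈ Jg ↔ ∀ i j, Valued.v (((k : GL (Fin 3) (w.1.adicCompletion L)) : Matrix (Fin 3) (Fin 3) (w.1.adicCompletion L)) i j) ≤
          Valued.v ϖ ^ (![![0, ν, 0], ![ν, 0, ν], ![1, ν, 0]] : Fin 3 → Fin 3 → ℕ) i j)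
      (Je : Subgroup (Gqs L v)) (_hJe : Je = Jg.comap eA.toMulEquiv.toMonoidHom)
      (w₀ : ↥(unitaryGroupOfForm (conjLocal L (IsCMField.complexConj L) v) (cmLocalForm L 3 v))) (_hw₀ : Units.val (w₀ : GL (Fin 3) (LocalRing L v)) = cmLocalForm L 3 v)
      [MeasurableSpace ↥(cmBorelTriple L 3 v).N] [BorelSpace ↥(cmBorelTriple L 3 v).N] (μ : Measure ↥(cmBorelTriple L 3 v).N) [μ.IsHaarMeasure]
      (f₁ f_w : haveI := locallyCompactSpace_cmBorelU L 3 v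
        Representation.SmoothInd (cmBorelTriple L 3 v).P
          (Representation.twist (((Representation.trivial ℂ ↥(torusU (conjLocal L (IsCMField.complexConj L) v) (cmLocalForm L 3 v)) ℂ).twist
            (cmTorusCharPair L v χ₁ 1)).comp (cmBorelTriple L 3 v).proj) (rootDeltaChar (cmBorelTriple L 3 v).P))),
      (∀ x ∈ Je, (haveI := locallyCompactSpace_cmBorelU L 3 v; Representation.smoothIndRep _ _ x f₁) =
        (if h : IsUnit (((x.val : GL (Fin 3) (LocalRing L v)) : Matrix (Fin 3) (Fin 3) (LocalRing L v)) 0 0) then ((χ₁ h.unit : ℂˣ) : ℂ) else 0) • f₁) →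
      (∀ x ∈ Je, (haveI := locallyCompactSpace_cmBorelU L 3 v; Representation.smoothIndRep _ _ x f_w) =
        (if h : IsUnit (((x.val : GL (Fin 3) (LocalRing L v)) : Matrix (Fin 3) (Fin 3) (LocalRing L v)) 0 0) then ((χ₁ h.unit : ℂˣ) : ℂ) else 0) • f_w) →
      f₁.toFun 1 = 1 → f₁.toFun w₀ = 0 → f_w.toFun 1 = 0 → f_w.toFun w₀ = 1 →
      ∃ V₁ V₂ : ℂ, V₁ ≠ 0 ∧ V₂ ≠ 0 ∧
        Integrable (fun n : ↥(cmBorelTriple L 3 v).N => f₁.toFun (w₀ * (n : ↥(unitaryGroupOfForm (conjLocal L (IsCMField.complexConj L) v) (cmLocalForm L 3 v))) * 1)) μ ∧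
        Integrable (fun n : ↥(cmBorelTriple L 3 v).N => f_w.toFun (w₀ * (n : ↥(unitaryGroupOfForm (conjLocal L (IsCMField.complexConj L) v) (cmLocalForm L 3 v))) * 1)) μ ∧
        Integrable (fun n : ↥(cmBorelTriple L 3 v).N => f₁.toFun (w₀ * (n : ↥(unitaryGroupOfForm (conjLocal L (IsCMField.complexConj L) v) (cmLocalForm L 3 v))) * w₀)) μ ∧
        Integrable (fun n : ↥(cmBorelTriple L 3 v).N => f_w.toFun (w₀ * (n : ↥(unitaryGroupOfForm (conjLocal L (IsCMField.complexConj L) v) (cmLocalForm L 3 v))) * w₀)) μ ∧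
        ∫ n : ↥(cmBorelTriple L 3 v).N, f_w.toFun (w₀ * (n : ↥(unitaryGroupOfForm (conjLocal L (IsCMField.complexConj L) v) (cmLocalForm L 3 v))) * 1) ∂μ =
          (((Ideal.absNorm w.1.asIdeal : ℝ) : ℂ) ^ ν)⁻¹ * V₂ ∧
        ∫ n : ↥(cmBorelTriple L 3 v).N, f₁.toFun (w₀ * (n : ↥(unitaryGroupOfForm (conjLocal L (IsCMField.complexConj L) v) (cmLocalForm L 3 v))) * w₀) ∂μ =
          (((Ideal.absNorm w.1.asIdeal : ℝ) : ℂ) ^ ν)⁻¹ * V₁ ∧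
        ((∫ n : ↥(cmBorelTriple L 3 v).N, f₁.toFun (w₀ * (n : ↥(unitaryGroupOfForm (conjLocal L (IsCMField.complexConj L) v) (cmLocalForm L 3 v))) * 1) ∂μ = 0 ∧
            ∫ n : ↥(cmBorelTriple L 3 v).N, f_w.toFun (w₀ * (n : ↥(unitaryGroupOfForm (conjLocal L (IsCMField.complexConj L) v) (cmLocalForm L 3 v))) * w₀) ∂μ = 0) ∨
          ((∃ a : (LocalRing L v)ˣ, Units.map (conjLocal L (IsCMField.complexConj L) v : LocalRing L v →* LocalRing L v) a = a ∧
              (∀ w' : PlacesOver L v, Valued.v ((a : LocalRing L v) w') = 1) ∧ χ₁ a ≠ 1) ∧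
            ∃ Γ : ℂ, Γ ^ 2 * ((χ₁ (Units.map (conjLocal L (IsCMField.complexConj L) v : LocalRing L v →* LocalRing L v) piU * piU) : ℂˣ) : ℂ) =
                (((Ideal.absNorm w.1.asIdeal : ℝ) : ℂ) - 1) ^ 2 * ((((Ideal.absNorm w.1.asIdeal : ℝ) : ℂ)) ^ (2 * ν + 1))⁻¹ ∧
              ∫ n : ↥(cmBorelTriple L 3 v).N, f₁.toFun (w₀ * (n : ↥(unitaryGroupOfForm (conjLocal L (IsCMField.complexConj L) v) (cmLocalForm L 3 v))) * 1) ∂μ =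
                V₁ * (Γ * ((χ₁ (Units.map (conjLocal L (IsCMField.complexConj L) v : LocalRing L v →* LocalRing L v) piU * piU) : ℂˣ) : ℂ) /
                  (1 - ((χ₁ (Units.map (conjLocal L (IsCMField.complexConj L) v : LocalRing L v →* LocalRing L v) piU * piU) : ℂˣ) : ℂ))) ∧
              ∫ n : ↥(cmBorelTriple L 3 v).N, f_w.toFun (w₀ * (n : ↥(unitaryGroupOfForm (conjLocal L (IsCMField.complexConj L) v) (cmLocalForm L 3 v))) * w₀) ∂μ =
                V₂ * (Γ * ((χ₁ (Units.map (conjLocal L (IsCMField.complexConj L) v : LocalRing L v →* LocalRing L v) piU * piU) : ℂˣ) : ℂ) /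
                  (1 - ((χ₁ (Units.map (conjLocal L (IsCMField.complexConj L) v : LocalRing L v →* LocalRing L v) piU * piU) : ℂˣ) : ℂ))))))
    (hred : ∃ N : Subrepresentation (cmPrincipalSeries L 3 v (cmTorusCharPair L v χ₁ 1)), N ≠ ⊥ ∧ N ≠ ⊤) :
    ∃ η : (LocalRing L v)ˣ →* ℂˣ, IsQuadraticCharExtension (conjLocal L (IsCMField.complexConj L) v) η ∧
      Continuous (fun x => ((η x : ℂˣ) : ℂ)) ∧ χ₁ = η * halfModulusChar (LocalRing L v) := by
  obtain ⟨w⟩ : Nonempty (PlacesOver L v) := inferInstance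
  have hw : IsCMField.complexConj L • w.1 = w.1 := hns w
  haveI : Algebra.IsQuadraticExtension ↥(maximalRealSubfield L) L := IsCMField.isQuadraticExtension L
  -- the guard `¬ IsUnramifiedIn` read at the unique place `w ∣ v`: `e(w|v) ≠ 1`; tameness `|2|_w = 1`
  have he : v.asIdeal.ramificationIdx' w.1.asIdeal ≠ 1 := fun he1 =>
    hrf (isUnramifiedIn_of_ramificationIdx'_eq_one L (IsCMField.complexConj L) v (IsCMField.complexConj_ne_one L) w hw he1)
  have h2w : Valued.v (2 : w.1.adicCompletion L) = 1 := h2 w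
  -- the (G3)-EXPLICIT frame letters (★ p863671 pattern): a uniformiser, `g₁ = diag(1,1,ϖ)`, `eA =` ★ `localNonsplitEquiv` on `Φ₃`
  obtain ⟨ϖ, hϖ⟩ : ∃ τ : w.1.adicCompletion L, Valued.v τ = WithZero.exp (-1 : ℤ) := by
    obtain ⟨π, hπ⟩ := w.1.valuation_exists_uniformizer L
    exact ⟨(π : w.1.adicCompletion L), by rw [HeightOneSpectrum.valuedAdicCompletion_eq_valuation', hπ]⟩
  have hϖ0 : ϖ ≠ 0 := fun h0 => by rw [h0, map_zero] at hϖ; exact WithZero.zero_ne_coe hϖ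
  have hvσ : ∀ x, Valued.v (galAdicCompletionMap (L := L) (IsCMField.complexConj L) hw x) = Valued.v x :=
    fun x => valued_galAdicCompletionMap (L := L) (IsCMField.complexConj L) hw x
  obtain ⟨g₁, hg₁⟩ : ∃ g₁ : GL (Fin 3) (w.1.adicCompletion L), (g₁ : Matrix (Fin 3) (Fin 3) (w.1.adicCompletion L)) = Matrix.diagonal ![(1 : w.1.adicCompletion L), 1, ϖ] := by
    refine ⟨glDiagonal 3 (w.1.adicCompletion L) ![1, 1, Units.mk0 ϖ hϖ0], ?_⟩
    rw [coe_glDiagonal]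
    congr 1
    funext i
    fin_cases i <;> rfl
  have hJw : placeForm (qsForm L) w.1 = (StdForm.antidiagonal 3).over (w.1.adicCompletion L) := by
    rw [placeForm, qsForm, antidiagOne_eq_over, StdForm.over_map]
  obtain ⟨eA, heA⟩ : ∃ eA : Gqs L v ≃ₜ* ↥(unitaryGroupOfForm (galAdicCompletionMap (L := L) (IsCMField.complexConj L) hw) ((StdForm.antidiagonal 3).over (w.1.adicCompletion L))),
      ∀ g : Gqs L v, ((eA g : ↥(unitaryGroupOfForm (galAdicCompletionMap (L := L) (IsCMField.complexConj L) hw) ((StdForm.antidiagonal 3).over (w.1.adicCompletion L)))) :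
          GL (Fin 3) (w.1.adicCompletion L)) =
        ((localNonsplitEquiv (IsCMField.complexConj L) (qsForm L) (IsCMField.complexConj_ne_one L) w hw g :
          ↥(unitaryGroupOfForm (galAdicCompletionMap (L := L) (IsCMField.complexConj L) hw) (placeForm (qsForm L) w.1))) : GL (Fin 3) (w.1.adicCompletion L)) := by
    rw [← hJw]
    exact ⟨localNonsplitEquiv (IsCMField.complexConj L) (qsForm L) (IsCMField.complexConj_ne_one L) w hw, fun g => rfl⟩
  -- `w₀ = eA⁻¹(w_long)` has matrix `Φ₃` (only its matrix is used: the element is abstracted)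
  obtain ⟨w₀, hw₀⟩ : ∃ w₀ : ↥(unitaryGroupOfForm (conjLocal L (IsCMField.complexConj L) v) (cmLocalForm L 3 v)),
      Units.val (w₀ : GL (Fin 3) (LocalRing L v)) = cmLocalForm L 3 v := by
    refine ⟨eA.symm (weylLongU (galAdicCompletionMap (L := L) (IsCMField.complexConj L) hw) (rfl : (StdForm.antidiagonal 3).over (w.1.adicCompletion L) = _)),
      Matrix.ext fun i j => ?_⟩
    rw [LocalRing.eq_iff_apply_eq (IsCMField.complexConj L) (IsCMField.complexConj_ne_one L) w hw,
      ← coe_eA_apply L v w hw eA heA (eA.symm (weylLongU (galAdicCompletionMap (L := L) (IsCMField.complexConj L) hw) rfl)) i j,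
      ContinuousMulEquiv.apply_symm_apply, coe_coe_weylLongU, cmLocalForm_eq_over]
    have h := congr_fun (congr_fun ((StdForm.antidiagonal 3).over_map (Pi.evalRingHom (fun w' : PlacesOver L v => w'.1.adicCompletion L) w)) i) j
    rw [Matrix.map_apply, Pi.evalRingHom_apply] at h
    exact h.symm
  -- a uniformiser unit `Π` of `L ⊗ L⁺_v` (★ `exists_unit_valued_apply_eq_exp_neg_one`, read at every `w′ = w`)
  obtain ⟨piU, hpiUw⟩ := exists_unit_valued_apply_eq_exp_neg_one L v w
  have hpiU : ∀ w' : PlacesOver L v, Valued.v ((piU : LocalRing L v) w') = WithZero.exp (-1 : ℤ) := fun w' => by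
    rw [PlacesOver.eq_of_smul_eq (IsCMField.complexConj L) (IsCMField.complexConj_ne_one L) w hw w']
    exact hpiUw
  -- ★ (B1): the conductor `m + 1 ≥ 2` (`hcond`) and its exact witness `u₁`; ★ (4): `m + 1 = ν + ν` is EVEN (tame Branch B, `hfixP` ★ (1)); Roche's exponents `(ν, ν)`
  obtain ⟨m, hm, hcond, u₁, hu₁, hχu₁⟩ := K2E3LocalCharacterConductorLetters.exists_conductor_letters L v w hϖ χ₁ h₁ hpos
  obtain ⟨ν, hmν⟩ := BposRamConductorEven.even_succ_of_conductorLetters_of_fixedPrincipal L v w hw he hϖ χ₁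
    (BposRamFixedPrincipalUnits.apply_eq_one_of_branchB_of_fixed_principal_ram L v w h2w χ₁ hB) hm hcond u₁ hu₁ hχu₁
  have hνν : ν + ν = m + 1 := hmν.symm
  -- ★ D174: Roche's two-depth group `Jg` at `e = (ν, 0; ν, 1)` and `Je := eA⁻¹(Jg)`
  obtain ⟨Jg, hJg⟩ := K2E3IwahoriTwoDepthFactorisation.exists_subgroup_forall_mem_iff_twoDepth (galAdicCompletionMap (L := L) (IsCMField.complexConj L) hw)
    (rfl : (StdForm.antidiagonal 3).over (w.1.adicCompletion L) = _) hvσ hϖ (r := ν) (s := 0) (r' := ν) (s' := 1)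
    (by omega) (by omega) (by omega) (by omega)
  -- the Haar measure of the closed subgroup `N(L⁺_v)` on its Borel σ-algebra
  letI : MeasurableSpace ↥(cmBorelTriple L 3 v).N := borel _
  haveI : BorelSpace ↥(cmBorelTriple L 3 v).N := ⟨rfl⟩
  haveI : LocallyCompactSpace ↥(unitaryGroupOfForm (conjLocal L (IsCMField.complexConj L) v) (cmLocalForm L 3 v)) :=
    locallyCompactSpace_local (IsCMField.complexConj L) 3 _ v
  haveI : LocallyCompactSpace ↥(cmBorelTriple L 3 v).N :=
    (LineRing.isClosed_unipotentU (conjLocal L (IsCMField.complexConj L) v) (cmLocalForm L 3 v)).isClosedEmbedding_subtypeVal.locallyCompactSpace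
  -- ★ (B-8): the θ-letters of ★ (B-1′) — `hθmul` (trace-one `t := 2⁻¹` by tameness, `hcondF` ★ (1) at `c = 1`) and the C-pack
  have ht : (2⁻¹ : w.1.adicCompletion L) + galAdicCompletionMap (L := L) (IsCMField.complexConj L) hw 2⁻¹ = 1 := by
    rw [map_inv₀, map_ofNat, ← two_mul, mul_inv_cancel₀ two_ne_zero]
  have hvt : Valued.v (2⁻¹ : w.1.adicCompletion L) ≤ 1 := by rw [map_inv₀, h2w, inv_one]
  have hcondF : ∀ u : (LocalRing L v)ˣ, Units.map (conjLocal L (IsCMField.complexConj L) v : LocalRing L v →* LocalRing L v) u = u →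
      (∀ w' : PlacesOver L v, Valued.v (((u : LocalRing L v) w') - 1) ≤ Valued.v ϖ ^ 1) → χ₁ u = 1 :=
    BposRamFixedPrincipalUnits.hcondF_of_branchB_of_tame L v w h2w hϖ le_rfl χ₁ hB
  have hθmul := BposCongruencePackTheta.theta_mul_twoDepth L v w hw eA heA hϖ ν 0 ν 1 Jg hJg _ rfl (by omega) le_rfl χ₁ (n := m + 1) (c := 1) le_rfl (by omega)
    hcond hcondF ht hvt (by omega) (by omega) (by omega) (by omega)
  obtain ⟨C, hCo, hθC⟩ := BposCongruencePackTheta.exists_isOpen_subgroup_theta_eq_one L v w hw eA heA hϖ (m + 1) (by omega) χ₁ hcond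
  -- ★ (B-1′): the normalised `(J_e, θ)`-type basis `(f₁, f_w)` of `i(χ₁, 1)` (Branch B)
  obtain ⟨f₁, f_w, heig₁, heig_w, h11, h1g, hw1, hwg⟩ :=
    BposBranchBTypeBasisTwoDepthCM.exists_normalised_typeBasis_twoDepth_of_normChar_eq_one L v w hw eA heA hϖ g₁ hg₁ _ _ _ rfl rfl rfl ν 0 ν 1 Jg hJg _ rfl
      w₀ hw₀ (by omega) le_rfl χ₁ hB hθmul C hCo hθC
  -- the letter `HEram` at this frame, this uniformiser unit and this basis
  obtain ⟨V₁, V₂, hV₁, hV₂, hi₁₁, hiw₁, hi₁₂, hiw₂, hw1v, h1wv, hbig⟩ :=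
    HEram w hw he h2w eA heA ϖ hϖ piU hpiU g₁ hg₁ _ _ _ rfl rfl rfl m hm hcond u₁ hu₁ hχu₁ ν hνν Jg hJg _ rfl w₀ hw₀ Measure.haar f₁ f_w heig₁ heig_w h11 h1g hw1 hwg
  -- §1
  exact exists_eta_of_reducible_twoDepth_of_pairEntries_ram L v w hw eA heA hϖ g₁ hg₁ _ _ _ rfl rfl rfl ν Jg hJg _ rfl w₀ hw₀ hns he h2w piU hpiU χ₁ h₁ hnu hcontr hB hm
    hcond u₁ hu₁ hχu₁ hνν Measure.haar f₁ f_w heig₁ heig_w h11 h1g hw1 hwg hi₁₁ hiw₁ hi₁₂ hiw₂ V₁ V₂ hV₁ hV₂ hw1v h1wv hbig hred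

end Summit.HodgeConjecture.HodgeConjecture.R90.S1.KeysThmTwoPosDepthBranchBRamifiedTameLeaf

end
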